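import Mathlib
import Literature.LinearAlgebra.Matrix.SpecialLinearReductionSurjective
import Summits.BirchSwinnertonDyer.BirchSwinnertonDyer.Theorems.KatoDescentTamePotSupersingularTameLowerFibreAdjointBricksFiveSmallLayer

/-!
# Bricks for the `GL₂(𝔽₅)`-lifting route (T5′), X: the ABSTRACT principal small layer of (P′),
# `W`-drop case, at every level

Continuation of file IX (`…AdjointBricksFiveSmallLayer`, same namespace). The other kind of principal small
layer `π : A → B` with residue field `𝔽₅`: the kernel is `5^m·A ≅ 𝔽₅` and the characteristic DROPS
(`A` of characteristic `5^{m+1}`, `B` of characteristic `5^m`, `m ≥ 1`; `W_A = ℤ/5^{m+1} ↠ W_B = ℤ/5^m`).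
File V (`smu_mem_of_forall_exists_map_eq`) is the instance `A = ℤ/5^{m+1}`; here `A ⊋ W_A` is allowed
(in Δ1 proper: the layers `𝒪_𝔭/𝔭^{n+1} → 𝒪_𝔭/𝔭ⁿ` with `e ∣ n`, e.g. `𝒪/ϖ³ → 𝒪/ϖ² = 𝔽₅[ε]` for `e = 2`).
SETTING (hypotheses, no definitions): `res : A → 𝔽₅` with `ann(5^m) = ker res`; `π : A → B` with kernel
`5^m A`; `H ≤ GL₂(A)` with `(det h)⁴ = 1` on `H` such that `π(H)` covers the image of `S^μ(ℤ/5^m)` in `GL₂(B)`.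
`smu_map_mem_of_smallDrop`: **then `H` contains the image of `S^μ(ℤ/5^{m+1})`** (conjugator `u = 1`) — in
particular the image of `SL₂(ℤ/5^{m+1})`. Proof = HOME/k8t-c2/g15 memo §3 (β), CASE `W_A ↠ W_B` at `r = 1`:
`N̄ = {X ∈ 𝔰𝔩₂(𝔽₅) : 1 + 5^m X̃ ∈ H}` is `Ad`-stable, so `0` or `𝔰𝔩₂` (file I); if `𝔰𝔩₂`, `H` contains the
kernel of `GL₂(π)` on `S^μ` and hence every `ι_A(g)`; if `0`, `π` is injective on `H ∩ π⁻¹(image)`, and the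
unique lifts `s(q) ∈ H` of `q ∈ SL₂(ℤ/5^m)` lie in `ι_A(GL₂(ℤ/5^{m+1}))` (`ι_A` injective as
`char A = 5^{m+1}`), giving a homomorphic section `SL₂(ℤ/5^m) → GL₂(ℤ/5^{m+1})` with `det ∈ μ₄` — excluded by
file II `not_exists_section_detPowFour`. Inputs: files I, II, IX, Andrianov–Zhuravlev lifting (Literature). Route-free,
no definitions, nothing about elliptic curves or items 19618/19981 (open). Target T-S7r07-1 (`FibreLatticeInput 5`).
-/

set_option linter.dupNamespace false

open Matrix

namespace Summit.BirchSwinnertonDyer.BirchSwinnertonDyer.Theorems.GL2F5AdjointBricks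

section smalldrop

variable {A B : Type*} [CommRing A] [CommRing B]

/-- **The abstract principal small layer of (P′), `W`-drop case, every level (ARM-P r07 S7 ADD-1 §C
(C0)/(C3); HOME/k8t-c2/g15 §3 (β)).** Let `A` have characteristic `5^{m+1}` (`m ≥ 1`) and a residue map
`res : A → 𝔽₅` with `ann(5^m) = ker res`; let `π : A → B` have kernel `5^m A`, `B` of characteristic `5^m`.
If `H ≤ GL₂(A)` has `(det h)⁴ = 1` on `H` and `π(H)` covers the image of `S^μ(ℤ/5^m)` in `GL₂(B)`, then `H`
contains the image of `S^μ(ℤ/5^{m+1}) = {g ∈ GL₂(ℤ/5^{m+1}) : (det g)⁴ = 1}` in `GL₂(A)` — in particular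
the image of `SL₂(ℤ/5^{m+1})`. -/
theorem smu_map_mem_of_smallDrop (m : ℕ) (hm : 1 ≤ m) [CharP A (5 ^ (m + 1))] [CharP B (5 ^ m)]
    (π : A →+* B) (res : A →+* ZMod 5)
    (hann : ∀ a, (5 : A) ^ m * a = 0 ↔ res a = 0) (hker : ∀ a, π a = 0 ↔ ∃ x, a = (5 : A) ^ m * x)
    (H : Subgroup (GL (Fin 2) A))
    (hHμ : ∀ h ∈ H, Matrix.det (h : Matrix (Fin 2) (Fin 2) A) ^ 4 = 1)
    (hcover : ∀ q : GL (Fin 2) (ZMod (5 ^ m)),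
      Matrix.det (q : Matrix (Fin 2) (Fin 2) (ZMod (5 ^ m))) ^ 4 = 1 →
        ∃ h ∈ H, Matrix.GeneralLinearGroup.map π h =
          Matrix.GeneralLinearGroup.map (ZMod.castHom (dvd_refl (5 ^ m)) B) q)
    (g : GL (Fin 2) (ZMod (5 ^ (m + 1))))
    (hg : Matrix.det (g : Matrix (Fin 2) (Fin 2) (ZMod (5 ^ (m + 1)))) ^ 4 = 1) :
    Matrix.GeneralLinearGroup.map (ZMod.castHom (dvd_refl (5 ^ (m + 1))) A) g ∈ H := by
  classical
  have h25 : (2 : ZMod 5) ≠ 0 := by decide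
  have h45 : (4 : ZMod 5) ≠ 0 := by decide
  have h55 : (5 : ZMod 5) = 0 := by decide
  haveI : NeZero (5 ^ (m + 1)) := ⟨pow_ne_zero _ (by norm_num)⟩
  haveI : NeZero (5 ^ m) := ⟨pow_ne_zero _ (by norm_num)⟩
  haveI : Fact (Nat.Prime 5) := ⟨by norm_num⟩
  have hm0 : m ≠ 0 := by omega
  -- the element `t = 5^m`
  set t : A := (5 : A) ^ m with ht_def
  have ht : res t = 0 := by rw [ht_def, map_pow, map_ofNat, h55, zero_pow hm0]
  have htt : t * t = 0 := (hann t).2 ht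
  have htm : ∀ a, res a = 0 → t * a = 0 := fun a ha => (hann a).2 ha
  have hπt : π t = 0 := (hker t).2 ⟨1, (mul_one t).symm⟩
  -- notation
  set c5 := ZMod.castHom (dvd_pow_self 5 (Nat.succ_ne_zero m)) (ZMod 5) with hc5
  set cm := ZMod.castHom (pow_dvd_pow 5 m.le_succ) (ZMod (5 ^ m)) with hcm
  set red := Matrix.GeneralLinearGroup.map (n := Fin 2) c5 with hred
  set redm := Matrix.GeneralLinearGroup.map (n := Fin 2) cm with hredm
  set castA := ZMod.castHom (dvd_refl (5 ^ (m + 1))) A with hcastA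
  set ιA := Matrix.GeneralLinearGroup.map (n := Fin 2) castA with hιA
  set ιB := Matrix.GeneralLinearGroup.map (n := Fin 2) (ZMod.castHom (dvd_refl (5 ^ m)) B) with hιB
  set πG := Matrix.GeneralLinearGroup.map (n := Fin 2) π with hπG
  set ρ := Matrix.GeneralLinearGroup.map (n := Fin 2) res with hρ
  have hπι : ∀ x, πG (ιA x) = ιB (redm x) := by
    intro x
    have hc : π.comp castA = (ZMod.castHom (dvd_refl (5 ^ m)) B).comp cm := Subsingleton.elim _ _
    have h : Matrix.GeneralLinearGroup.map (n := Fin 2) (π.comp castA) x =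
        Matrix.GeneralLinearGroup.map (n := Fin 2) ((ZMod.castHom (dvd_refl (5 ^ m)) B).comp cm) x := by rw [hc]
    rw [Matrix.GeneralLinearGroup.map_comp, Matrix.GeneralLinearGroup.map_comp] at h
    exact h
  have hρι : ∀ x, ρ (ιA x) = red x := by
    intro x
    have hc : res.comp castA = c5 := Subsingleton.elim _ _
    have h : Matrix.GeneralLinearGroup.map (n := Fin 2) (res.comp castA) x = red x := by rw [hc]
    rw [Matrix.GeneralLinearGroup.map_comp] at h
    exact h
  have hρval : ∀ h : GL (Fin 2) A, (ρ h).val = (h.val).map res := fun h => rfl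
  have hπGval : ∀ h : GL (Fin 2) A, (πG h).val = (h.val).map π := fun h => rfl
  have hιAval : ∀ x : GL (Fin 2) (ZMod (5 ^ (m + 1))), (ιA x).val = (x.val).map castA := fun x => rfl
  have hredmval : ∀ x : GL (Fin 2) (ZMod (5 ^ (m + 1))), (redm x).val = (x.val).map cm := fun x => rfl
  have hιA_inj : Function.Injective ιA := by
    intro x y hxy
    apply Units.ext; ext i j
    have h := congrArg (fun z : GL (Fin 2) A => z.val i j) hxy
    simp only [hιAval, Matrix.map_apply] at h
    exact ZMod.castHom_injective A h
  -- determinants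
  have hdet_mul : ∀ a b : GL (Fin 2) A, Matrix.det ((a * b).val) = Matrix.det a.val * Matrix.det b.val := by
    intro a b; rw [Units.val_mul, Matrix.det_mul]
  have hdet_inv : ∀ a : GL (Fin 2) A, Matrix.det a.val ^ 4 = 1 → Matrix.det (a⁻¹).val ^ 4 = 1 := by
    intro a ha
    have h1 : Matrix.det a.val * Matrix.det (a⁻¹).val = 1 := by
      rw [← Matrix.det_mul, ← Units.val_mul, mul_inv_cancel, Units.val_one, Matrix.det_one]
    have h2 := congrArg (· ^ 4) h1
    simp only [mul_pow, ha, one_mul, one_pow] at h2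
    exact h2
  have hdetι : ∀ x : GL (Fin 2) (ZMod (5 ^ (m + 1))),
      Matrix.det (x : Matrix (Fin 2) (Fin 2) (ZMod (5 ^ (m + 1)))) ^ 4 = 1 →
        Matrix.det ((ιA x).val) ^ 4 = 1 := by
    intro x hx
    have hd : Matrix.det ((ιA x).val) = castA (Matrix.det (x : Matrix (Fin 2) (Fin 2) (ZMod (5 ^ (m + 1))))) := by
      rw [RingHom.map_det]; rfl
    rw [hd, ← map_pow, hx, map_one]
  have hμ_redm : ∀ x : GL (Fin 2) (ZMod (5 ^ (m + 1))),
      Matrix.det (x : Matrix (Fin 2) (Fin 2) (ZMod (5 ^ (m + 1)))) ^ 4 = 1 →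
        Matrix.det ((redm x : GL (Fin 2) (ZMod (5 ^ m))) : Matrix (Fin 2) (Fin 2) (ZMod (5 ^ m))) ^ 4 = 1 := by
    intro x hx
    have hd : Matrix.det ((redm x : GL (Fin 2) (ZMod (5 ^ m))) : Matrix (Fin 2) (Fin 2) (ZMod (5 ^ m))) =
        cm (Matrix.det (x : Matrix (Fin 2) (Fin 2) (ZMod (5 ^ (m + 1))))) := by
      rw [RingHom.map_det]; rfl
    rw [hd, ← map_pow, hx, map_one]
  -- the lift `L` and the kernel elements `τ X = 1 + t • L X`
  let L : Matrix (Fin 2) (Fin 2) (ZMod 5) → Matrix (Fin 2) (Fin 2) A := fun X =>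
    X.map (fun x : ZMod 5 => ((x.val : ℕ) : A))
  have hLres : ∀ X, (L X).map res = X := fun X => map_map_val_res res X
  have htL : ∀ M : Matrix (Fin 2) (Fin 2) A, t • M = t • L (M.map res) := fun M => smul_eq_smul_map_val htm M
  let τ : Matrix (Fin 2) (Fin 2) (ZMod 5) → GL (Fin 2) A := fun X =>
    ⟨1 + t • L X, 1 - t • L X, one_add_smul_mul_one_sub_smul htt (L X), one_sub_smul_mul_one_add_smul htt (L X)⟩
  have hτval : ∀ X, (τ X).val = 1 + t • L X := fun X => rfl
  have hτadd : ∀ X Y, τ (X + Y) = τ X * τ Y := by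
    intro X Y; apply Units.ext
    rw [Units.val_mul, hτval, hτval, hτval, one_add_smul_mul_one_add_smul htt, htL (L X + L Y), Matrix.map_add,
      hLres, hLres]
    exact fun a b => map_add res a b
  have hτzero : τ 0 = 1 := by
    apply Units.ext; rw [hτval, Units.val_one]
    have : L 0 = 0 := by ext i j; simp [L]
    rw [this, smul_zero, add_zero]
  have hπτ : ∀ X, πG (τ X) = 1 := by
    intro X; apply Units.ext; rw [hπGval, hτval, Units.val_one]
    ext i j
    simp only [Matrix.map_apply, Matrix.add_apply, Matrix.smul_apply, smul_eq_mul, map_add, map_mul, hπt,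
      zero_mul, add_zero, Matrix.one_apply]
    split_ifs <;> simp
  have hρτ : ∀ X, ρ (τ X) = 1 := by
    intro X; apply Units.ext; rw [hρval, hτval, Units.val_one]
    ext i j
    simp only [Matrix.map_apply, Matrix.add_apply, Matrix.smul_apply, smul_eq_mul, map_add, map_mul, ht,
      zero_mul, add_zero, Matrix.one_apply]
    split_ifs <;> simp
  have hconj : ∀ (h : GL (Fin 2) A) (X : Matrix (Fin 2) (Fin 2) (ZMod 5)),
      h * τ X * h⁻¹ = τ ((ρ h).val * X * ((ρ h)⁻¹).val) := by
    intro h X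
    apply Units.ext
    rw [Units.val_mul, Units.val_mul, hτval, hτval,
      mul_one_add_smul_mul t _ _ (L X) (by rw [← Units.val_mul, mul_inv_cancel, Units.val_one]),
      htL (h.val * L X * (h⁻¹).val)]
    congr 2
    rw [Matrix.map_mul, Matrix.map_mul, hLres, ← map_inv, hρval, hρval]
  have hK : ∀ k : GL (Fin 2) A, πG k = 1 → ∃ X, k = τ X := by
    intro k hk
    have hent : ∀ i j, ∃ x : A, (k.val - 1) i j = t * x := by
      intro i j
      apply (hker _).1
      have h := congrArg (fun z : GL (Fin 2) B => z.val i j) hk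
      simp only [hπGval, Matrix.map_apply, Units.val_one] at h
      rw [Matrix.sub_apply, map_sub, h, Matrix.one_apply, Matrix.one_apply]
      split_ifs <;> simp
    choose x hx using hent
    refine ⟨(Matrix.of fun i j => x i j).map res, Units.ext ?_⟩
    rw [hτval, ← htL]
    ext i j
    have h := hx i j
    rw [Matrix.sub_apply, sub_eq_iff_eq_add'] at h
    rw [h, Matrix.add_apply, Matrix.smul_apply, Matrix.of_apply, smul_eq_mul]
  have htr_of_det : ∀ X, Matrix.det ((τ X).val) ^ 4 = 1 → Matrix.trace X = 0 := by
    intro X hX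
    rw [hτval, det_one_add_smul htt, one_add_mul_pow_four htt, add_eq_left, ← mul_assoc,
      mul_comm (4 : A) t, mul_assoc, hann, map_mul, map_add] at hX
    have h4 : (res 4 : ZMod 5) = 4 := map_ofNat res 4
    rw [h4] at hX
    have hLr : ∀ i, res (L X i i) = X i i := fun i => by
      have := congrArg (fun M : Matrix (Fin 2) (Fin 2) (ZMod 5) => M i i) (hLres X)
      simpa only [Matrix.map_apply] using this
    rw [hLr, hLr] at hX
    rw [Matrix.trace_fin_two]
    rcases mul_eq_zero.1 hX with h | h
    · exact absurd h h45
    · exact h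
  -- chosen lifts `s q ∈ H` over `ιB q`, `q ∈ S^μ(ℤ/5^m)`
  have hcover' : ∀ q : GL (Fin 2) (ZMod (5 ^ m)), ∃ h : GL (Fin 2) A,
      Matrix.det (q : Matrix (Fin 2) (Fin 2) (ZMod (5 ^ m))) ^ 4 = 1 → h ∈ H ∧ πG h = ιB q := by
    intro q
    by_cases hq : Matrix.det (q : Matrix (Fin 2) (Fin 2) (ZMod (5 ^ m))) ^ 4 = 1
    · obtain ⟨h, hH, hh⟩ := hcover q hq; exact ⟨h, fun _ => ⟨hH, hh⟩⟩
    · exact ⟨1, fun h => absurd h hq⟩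
  choose s hs using hcover'
  -- over `x ∈ S^μ(ℤ/5^{m+1})`: `s (redm x) = τ (c x) * ιA x`
  have hc_ex : ∀ x : GL (Fin 2) (ZMod (5 ^ (m + 1))), ∃ X : Matrix (Fin 2) (Fin 2) (ZMod 5),
      Matrix.det (x : Matrix (Fin 2) (Fin 2) (ZMod (5 ^ (m + 1)))) ^ 4 = 1 → s (redm x) = τ X * ιA x := by
    intro x
    by_cases hx : Matrix.det (x : Matrix (Fin 2) (Fin 2) (ZMod (5 ^ (m + 1)))) ^ 4 = 1
    · have hk : πG (s (redm x) * (ιA x)⁻¹) = 1 := by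
        rw [map_mul, map_inv, (hs _ (hμ_redm x hx)).2, ← hπι, mul_inv_cancel]
      obtain ⟨X, hX⟩ := hK _ hk
      exact ⟨X, fun _ => by rw [← hX, inv_mul_cancel_right]⟩
    · exact ⟨0, fun h => absurd h hx⟩
  choose c hc using hc_ex
  have hc_tr : ∀ x : GL (Fin 2) (ZMod (5 ^ (m + 1))),
      Matrix.det (x : Matrix (Fin 2) (Fin 2) (ZMod (5 ^ (m + 1)))) ^ 4 = 1 → Matrix.trace (c x) = 0 := by
    intro x hx
    apply htr_of_det
    have h1 : Matrix.det ((s (redm x)).val) ^ 4 = 1 := hHμ _ (hs _ (hμ_redm x hx)).1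
    have h2 : τ (c x) = s (redm x) * (ιA x)⁻¹ := by rw [hc x hx, mul_inv_cancel_right]
    rw [h2, hdet_mul, mul_pow, h1, one_mul]
    exact hdet_inv _ (hdetι x hx)
  -- the subspace `N̄ = {X : τ X ∈ H}`; it is trace-free and `Ad`-stable
  let Nbar : Submodule (ZMod 5) (Matrix (Fin 2) (Fin 2) (ZMod 5)) :=
    { carrier := {X | τ X ∈ H}
      add_mem' := by
        intro X X' hX hX'
        show τ (X + X') ∈ H
        rw [hτadd]; exact H.mul_mem hX hX'
      zero_mem' := by show τ 0 ∈ H; rw [hτzero]; exact H.one_mem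
      smul_mem' := by
        intro a X hX
        show τ (a • X) ∈ H
        have ha : a • X = a.val • X := by
          rw [← ZMod.natCast_zmod_val a, Nat.cast_smul_eq_nsmul]; simp
        rw [ha]
        induction a.val with
        | zero => rw [zero_smul, hτzero]; exact H.one_mem
        | succ n ih => rw [succ_nsmul, hτadd]; exact H.mul_mem ih hX }
  have hNmem : ∀ X, X ∈ Nbar ↔ τ X ∈ H := fun X => Iff.rfl
  have hNtr : ∀ X ∈ Nbar, Matrix.trace X = 0 := fun X hX => htr_of_det X (hHμ _ ((hNmem X).1 hX))
  have hNconj : ∀ h ∈ H, ∀ X ∈ Nbar, (ρ h).val * X * ((ρ h)⁻¹).val ∈ Nbar := by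
    intro h hh X hX
    rw [hNmem] at hX ⊢
    rw [← hconj h X]; exact H.mul_mem (H.mul_mem hh hX) (H.inv_mem hh)
  let uW : GL (Fin 2) (ZMod (5 ^ (m + 1))) :=
    ⟨!![1, 1; 0, 1], !![1, -1; 0, 1], by rw [Matrix.mul_fin_two, Matrix.one_fin_two]; simp,
      by rw [Matrix.mul_fin_two, Matrix.one_fin_two]; simp⟩
  let vW : GL (Fin 2) (ZMod (5 ^ (m + 1))) :=
    ⟨!![1, 0; 1, 1], !![1, 0; -1, 1], by rw [Matrix.mul_fin_two, Matrix.one_fin_two]; simp,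
      by rw [Matrix.mul_fin_two, Matrix.one_fin_two]; simp⟩
  have huWval : uW.val = !![1, 1; 0, 1] := rfl
  have huWinv : (uW⁻¹).val = !![1, -1; 0, 1] := rfl
  have hvWval : vW.val = !![1, 0; 1, 1] := rfl
  have hvWinv : (vW⁻¹).val = !![1, 0; -1, 1] := rfl
  have hredval : ∀ x : GL (Fin 2) (ZMod (5 ^ (m + 1))), (red x).val = (x.val).map c5 := fun x => rfl
  have huWdet : Matrix.det (uW : Matrix (Fin 2) (Fin 2) (ZMod (5 ^ (m + 1)))) ^ 4 = 1 := by
    rw [huWval, Matrix.det_fin_two_of]; ring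
  have hvWdet : Matrix.det (vW : Matrix (Fin 2) (Fin 2) (ZMod (5 ^ (m + 1)))) ^ 4 = 1 := by
    rw [hvWval, Matrix.det_fin_two_of]; ring
  have hred_u : (red uW).val = !![1, 1; 0, 1] := by
    rw [hredval, huWval]; ext i j; fin_cases i <;> fin_cases j <;> simp
  have hred_u' : ((red uW)⁻¹).val = !![1, -1; 0, 1] := by
    rw [← map_inv, hredval, huWinv]; ext i j; fin_cases i <;> fin_cases j <;> simp
  have hred_v : (red vW).val = !![1, 0; 1, 1] := by
    rw [hredval, hvWval]; ext i j; fin_cases i <;> fin_cases j <;> simp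
  have hred_v' : ((red vW)⁻¹).val = !![1, 0; -1, 1] := by
    rw [← map_inv, hredval, hvWinv]; ext i j; fin_cases i <;> fin_cases j <;> simp
  have hρs : ∀ x : GL (Fin 2) (ZMod (5 ^ (m + 1))),
      Matrix.det (x : Matrix (Fin 2) (Fin 2) (ZMod (5 ^ (m + 1)))) ^ 4 = 1 → ρ (s (redm x)) = red x := by
    intro x hx
    rw [hc x hx, map_mul, hρτ, one_mul, hρι]
  have hNu : ∀ X ∈ Nbar, !![1, 1; 0, 1] * X * !![1, -1; 0, 1] ∈ Nbar := by
    intro X hX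
    have h := hNconj (s (redm uW)) (hs _ (hμ_redm uW huWdet)).1 X hX
    rwa [hρs uW huWdet, hred_u, hred_u'] at h
  have hNv : ∀ X ∈ Nbar, !![1, 0; 1, 1] * X * !![1, 0; -1, 1] ∈ Nbar := by
    intro X hX
    have h := hNconj (s (redm vW)) (hs _ (hμ_redm vW hvWdet)).1 X hX
    rwa [hρs vW hvWdet, hred_v, hred_v'] at h
  have dich := traceless_submodule_eq_bot_or_top (F := ZMod 5) h25 Nbar hNtr hNu hNv
  rcases dich with hbot | htop
  swap
  · -- `N̄ = 𝔰𝔩₂`: `τ (c g) ∈ H`, so `ιA g ∈ H`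
    have hτc : τ (c g) ∈ H := (hNmem _).1 (htop (c g) (hc_tr g hg))
    have hq : ιA g = (τ (c g))⁻¹ * s (redm g) := by rw [hc g hg, inv_mul_cancel_left]
    rw [hq]; exact H.mul_mem (H.inv_mem hτc) (hs _ (hμ_redm g hg)).1
  -- `N̄ = 0`: the lifts `s` are unique, hence multiplicative, and they come from `GL₂(ℤ/5^{m+1})`:
  -- a homomorphic section `SL₂(ℤ/5^m) → GL₂(ℤ/5^{m+1})` with `det ∈ μ₄` — impossible (file II).
  exfalso
  have hker1 : ∀ k ∈ H, πG k = 1 → k = 1 := by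
    intro k hk hk1
    obtain ⟨X, hX⟩ := hK k hk1
    have hX0 : X = 0 := by
      have hXN : X ∈ Nbar := by rw [hNmem, ← hX]; exact hk
      rw [hbot] at hXN
      exact (Submodule.mem_bot (R := ZMod 5)).1 hXN
    rw [hX, hX0, hτzero]
  have hs_mul : ∀ q q' : GL (Fin 2) (ZMod (5 ^ m)),
      Matrix.det (q : Matrix (Fin 2) (Fin 2) (ZMod (5 ^ m))) ^ 4 = 1 →
      Matrix.det (q' : Matrix (Fin 2) (Fin 2) (ZMod (5 ^ m))) ^ 4 = 1 →
        s q * s q' = s (q * q') := by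
    intro q q' hq hq'
    have hqq' : Matrix.det ((q * q' : GL (Fin 2) (ZMod (5 ^ m))) : Matrix (Fin 2) (Fin 2) (ZMod (5 ^ m))) ^ 4 = 1 := by
      rw [Units.val_mul, Matrix.det_mul, mul_pow, hq, hq', one_mul]
    have h1 : πG (s q * s q' * (s (q * q'))⁻¹) = 1 := by
      rw [map_mul, map_mul, map_inv, (hs q hq).2, (hs q' hq').2, (hs _ hqq').2, map_mul, mul_inv_cancel]
    have h2 := hker1 _ (H.mul_mem (H.mul_mem (hs q hq).1 (hs q' hq').1) (H.inv_mem (hs _ hqq').1)) h1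
    rw [mul_inv_eq_one] at h2
    exact h2
  -- lifts of `SL₂(ℤ/5^m)` to `SL₂(ℤ/5^{m+1})` (Andrianov–Zhuravlev via `SL₂(ℤ)`)
  have hlift : ∀ q : Matrix.SpecialLinearGroup (Fin 2) (ZMod (5 ^ m)),
      ∃ S : Matrix.SpecialLinearGroup (Fin 2) (ZMod (5 ^ (m + 1))), Matrix.SpecialLinearGroup.map cm S = q := by
    intro q
    obtain ⟨V, hV⟩ :=
      Literature.LinearAlgebra.Matrix.IntegerSpecialLinear.exists_specialLinearGroup_map_intCast_eq (5 ^ m) q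
    refine ⟨Matrix.SpecialLinearGroup.map (Int.castRingHom (ZMod (5 ^ (m + 1)))) V, ?_⟩
    rw [← hV]
    apply Subtype.ext
    ext i j
    simp only [hcm, Matrix.SpecialLinearGroup.map_apply_coe, RingHom.mapMatrix_apply, Matrix.map_apply,
      eq_intCast, map_intCast]
  choose σ hσ using hlift
  -- `t₀ = 5^m ∈ ℤ/5^{m+1}` and the kernel elements upstairs
  set t₀ : ZMod (5 ^ (m + 1)) := (5 : ZMod (5 ^ (m + 1))) ^ m with ht₀
  have h0 : (5 : ZMod (5 ^ (m + 1))) ^ (m + 1) = 0 := by exact_mod_cast ZMod.natCast_self (5 ^ (m + 1))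
  have ht₀t₀ : t₀ * t₀ = 0 := by
    rw [ht₀, ← pow_add]; exact pow_eq_zero_of_le (by omega) h0
  have hcmt₀ : cm t₀ = 0 := by
    rw [ht₀, map_pow, map_ofNat]; exact_mod_cast ZMod.natCast_self (5 ^ m)
  have hcastt₀ : castA t₀ = t := by rw [ht₀, map_pow, map_ofNat, ht_def]
  let C : GL (Fin 2) (ZMod (5 ^ (m + 1))) → Matrix (Fin 2) (Fin 2) (ZMod (5 ^ (m + 1))) := fun x =>
    (c x).map (fun y : ZMod 5 => ((y.val : ℕ) : ZMod (5 ^ (m + 1))))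
  let W : GL (Fin 2) (ZMod (5 ^ (m + 1))) → GL (Fin 2) (ZMod (5 ^ (m + 1))) := fun x =>
    ⟨1 + t₀ • C x, 1 - t₀ • C x, one_add_smul_mul_one_sub_smul ht₀t₀ (C x),
      one_sub_smul_mul_one_add_smul ht₀t₀ (C x)⟩
  have hWval : ∀ x, (W x).val = 1 + t₀ • C x := fun x => rfl
  have hιW : ∀ x, ιA (W x) = τ (c x) := by
    intro x; apply Units.ext
    rw [hιAval, hWval, hτval]
    ext i j
    simp only [Matrix.map_apply, Matrix.add_apply, Matrix.smul_apply, smul_eq_mul, map_add, map_mul, hcastt₀,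
      Matrix.one_apply, C, L, map_natCast]
    split_ifs <;> simp
  have hredmW : ∀ x, redm (W x) = 1 := by
    intro x; apply Units.ext
    rw [hredmval, hWval, Units.val_one]
    ext i j
    simp only [Matrix.map_apply, Matrix.add_apply, Matrix.smul_apply, smul_eq_mul, map_add, map_mul, hcmt₀,
      zero_mul, add_zero, Matrix.one_apply]
    split_ifs <;> simp
  -- the section
  let S : Matrix.SpecialLinearGroup (Fin 2) (ZMod (5 ^ m)) → GL (Fin 2) (ZMod (5 ^ (m + 1))) := fun q =>
    W (Matrix.SpecialLinearGroup.toGL (σ q)) * Matrix.SpecialLinearGroup.toGL (σ q)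
  have hσdet : ∀ q, Matrix.det ((Matrix.SpecialLinearGroup.toGL (σ q) : GL (Fin 2) (ZMod (5 ^ (m + 1)))) :
      Matrix (Fin 2) (Fin 2) (ZMod (5 ^ (m + 1)))) ^ 4 = 1 := by
    intro q; rw [Matrix.SpecialLinearGroup.coe_GL_coe_matrix, (σ q).prop, one_pow]
  have hσred : ∀ q, redm (Matrix.SpecialLinearGroup.toGL (σ q)) = Matrix.SpecialLinearGroup.toGL q := by
    intro q; apply Units.ext
    rw [hredmval, Matrix.SpecialLinearGroup.coe_GL_coe_matrix, Matrix.SpecialLinearGroup.coe_GL_coe_matrix]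
    have h := congrArg (fun z : Matrix.SpecialLinearGroup (Fin 2) (ZMod (5 ^ m)) =>
      (z : Matrix (Fin 2) (Fin 2) (ZMod (5 ^ m)))) (hσ q)
    simpa only [Matrix.SpecialLinearGroup.map_apply_coe, RingHom.mapMatrix_apply] using h
  have hqdet : ∀ q : Matrix.SpecialLinearGroup (Fin 2) (ZMod (5 ^ m)),
      Matrix.det ((Matrix.SpecialLinearGroup.toGL q : GL (Fin 2) (ZMod (5 ^ m))) :
        Matrix (Fin 2) (Fin 2) (ZMod (5 ^ m))) ^ 4 = 1 := by
    intro q; rw [Matrix.SpecialLinearGroup.coe_GL_coe_matrix, q.prop, one_pow]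
  have hιS : ∀ q, ιA (S q) = s (Matrix.SpecialLinearGroup.toGL q) := by
    intro q
    show ιA (W _ * _) = _
    rw [map_mul, hιW, ← hσred q, hc _ (hσdet q)]
  have hSmul : ∀ q q', S (q * q') = S q * S q' := by
    intro q q'
    apply hιA_inj
    rw [hιS, map_mul ιA (S q) (S q'), hιS, hιS, hs_mul _ _ (hqdet q) (hqdet q'),
      map_mul Matrix.SpecialLinearGroup.toGL q q']
  have hSone : S 1 = 1 := by
    have h := hSmul 1 1; rw [mul_one] at h; exact mul_eq_left.1 h.symm
  let Sh : Matrix.SpecialLinearGroup (Fin 2) (ZMod (5 ^ m)) →* GL (Fin 2) (ZMod (5 ^ (m + 1))) :=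
    { toFun := S, map_one' := hSone, map_mul' := hSmul }
  apply not_exists_section_detPowFour m hm
  refine ⟨Sh, fun q => ?_, fun q => ?_⟩
  · -- `det (S q) ∈ μ₄`: its image in `A` is `det (s q)`
    show Matrix.det ((S q).val) ^ 4 = 1
    have h1 : castA (Matrix.det ((S q).val) ^ 4) = castA 1 := by
      rw [map_pow, map_one]
      have h := hHμ _ (hs _ (hqdet q)).1
      rw [← hιS, hιAval, ← RingHom.mapMatrix_apply, ← RingHom.map_det] at h
      exact h
    exact ZMod.castHom_injective A h1
  · -- reduction: `cm (S q) = q`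
    show cm.mapMatrix ((S q).val) = (q : Matrix (Fin 2) (Fin 2) (ZMod (5 ^ m)))
    have h : (redm (S q)).val = (Matrix.SpecialLinearGroup.toGL q).val := by
      show (redm (W _ * _)).val = _
      rw [map_mul, hredmW, one_mul, hσred]
    rw [hredmval, Matrix.SpecialLinearGroup.coe_GL_coe_matrix] at h
    exact h

end smalldrop

end Summit.BirchSwinnertonDyer.BirchSwinnertonDyer.Theorems.GL2F5AdjointBricks
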